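import Summits.ResolutionOfSingularities.ResolutionOfSingularities.Theses.RadicialJung
import Summits.ResolutionOfSingularities.ResolutionOfSingularities.Theorems.PAlterationPalterationThesisIffSummit
import Summits.ResolutionOfSingularities.ResolutionOfSingularities.Theorems.RadicialJungCleanModelsSuffice

/-!
# Where the crux `CleanModels` (stmt-ResolutionOfSingularities-15917) sits relative to the summit — r1 strategist record

Planner workfile (redirect strategist r1, 2026-08-17; companion of `Cruxes/CleanModels/STRATEGY-CENSUS.md` §2).
Kernel-checked facts, all by composing LANDED theorems:

* `summit_imp_pialt` — the flagged conjunct `Pialt` (stmt-0555) is a CONSEQUENCE of the summit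
  (`Theorems.resolutionOfSingularities_iff_pialt_and_picover`);
* `summit_of_kato_cleanModels_pialt` — modulo the printed fact Kato 1994 (10.4)
  (`Kato1994_logRegularScheme_hasResolution`, vendored; `_holds` pending), `CleanModels ∧ Pialt ⇒ summit`
  (`RadicialJung.closes` + `CleanModelsSuffice_of_kato`, p151334);
* `summit_iff_pialt_of_kato_cleanModels` — hence, modulo Kato (10.4), the deciding crux turns the summit into EXACTLY
  its residual conjunct: `CleanModels → (ResolutionOfSingularities ↔ Pialt)`.

No theorem in either direction between `CleanModels` and the summit, `Pialt`, `Picover` or its degree-`p` residue exists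
(probes `bc/CleanModels_probe_split.lean`, `bc/CleanModels_probe_conjuncts.lean`, `#h21_crux_probe` VERDICT CLEAN — item
evidence of 2026-08-17): `CleanModels` is logically incomparable with the summit and a strict strengthening (mod Kato (10.4)) of
the conjunct `PicoverDegP` of the proved split `S ↔ Pialt ∧ PicoverDegP`; `Pialt` is the residual.
-/

set_option linter.dupNamespace false -- mandated namespace of this single-conjunct summit

namespace Summit.ResolutionOfSingularities.ResolutionOfSingularities.Cruxes.CleanModels.PositionR1

open Literature.AlgebraicGeometry.Resolution
open Summit.ResolutionOfSingularities.ResolutionOfSingularities.Theses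
open Summit.ResolutionOfSingularities.ResolutionOfSingularities

/-- The flagged conjunct is a consequence of the summit: `S → Pialt`. [folklore] -/
theorem summit_imp_pialt : _root_.ResolutionOfSingularities → RadicialJung.Pialt :=
  fun h => (Theorems.resolutionOfSingularities_iff_pialt_and_picover.mp h).1

/-- Modulo Kato 1994 (10.4): `CleanModels ∧ Pialt ⇒ summit` (the route's certified bridge). [folklore] -/
theorem summit_of_kato_cleanModels_pialt (hK : Kato1994_logRegularScheme_hasResolution.{0})
    (hC : RadicialJung.CleanModels) (hP : RadicialJung.Pialt) : _root_.ResolutionOfSingularities :=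
  RadicialJung.closes hC hP (Theorems.RadicialJung.CleanModelsSuffice.CleanModelsSuffice_of_kato hK)

/-- Modulo Kato 1994 (10.4): the deciding crux makes the summit equivalent to its residual conjunct `Pialt`. [folklore] -/
theorem summit_iff_pialt_of_kato_cleanModels (hK : Kato1994_logRegularScheme_hasResolution.{0})
    (hC : RadicialJung.CleanModels) : _root_.ResolutionOfSingularities ↔ RadicialJung.Pialt :=
  ⟨summit_imp_pialt, fun hP => summit_of_kato_cleanModels_pialt hK hC hP⟩

end Summit.ResolutionOfSingularities.ResolutionOfSingularities.Cruxes.CleanModels.PositionR1
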